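import Summits.BirchSwinnertonDyer.BirchSwinnertonDyer.Theorems.GenusKolyvaginAtTwoPowDvdShaCardAtTwoPosTGenusIndexLaw
import Summits.BirchSwinnertonDyer.BirchSwinnertonDyer.Theorems.GenusKolyvaginAtTwoPowDvdShaCardAtTwoRTMilneDefect
import Literature.NumberTheory.EllipticCurves.HeegnerPointsKolyvaginExceptionalTwistProofs
import HarnessLib

/-!
# Route `GenusKolyvaginAtTwo`, LINES 18/19 v4.2 (L_T stmt-BirchSwinnertonDyer-23242 / L⁺_T stmt-23379): KOLYVAGIN'S THEOREM
# FROM THE ROUTE'S DISPLAYED PUBLISHED INPUTS, and the print stubs K / 3b″ over the FOUR route items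
# {`GrossZagierAllLevels` 24148, `MultPublishedInputsAtTwo` 19921, `EntireLFunctionRat` 19273, `MilneAnyModel` 24149}

Seat `bsd-line-gk2-p2` g14 (cell `bsd-f1-sign2`), `--supports` (helper; closes nothing).  THEOREMS ONLY (no definition, no new
named fact, no `sorry`); BSD is not proved by any of this.

The pen's v4.2 by-name stub `stub_pubInputsAtTwo : PubInputsAtTwo := GrossZagierAllLevels ∧ (∀ N W K, kolyvagin N W K) ∧
MultPublishedInputsAtTwo ∧ EntireLFunctionRat ∧ MilneAnyModel` carries Kolyvagin's theorem (Gross 1991 Thm. 1.3) as a SECOND conjunct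
only "so that 3b″ closes by a one-line `exact` TODAY" (pen HANDOFF §g11; its 23:32Z ask to the GK2 provers: «bridge PubInputs ⇒
kolyvagin»).  The conjunct is REDUNDANT: the named fact `kolyvagin N W K` (a non-torsion Heegner point of level `N` over an imaginary
quadratic `K` with the Heegner hypothesis for `N` ⇒ `rank_ℤ E(K) = 1` and `Ш(E/K)` finite) FOLLOWS from three of the route's four
displayed published items — the hypotheses `hGZ`, `hGZK`, `hL` of the route's `closes`:
* Gross–Zagier at `(N, E, K)` (`gross_zagier N W K`, all levels = item 24148): `ĥ(y_K) ≠ 0 ⇒ L'(E/K,1) ≠ 0`, so with the entire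
  continuation (item 19273) `ord_{s=1} L(E,s) + ord_{s=1} L(E^{(d_K)},s) ≤ 1` — tree THEOREM
  `analyticRank_add_le_one_of_isHeegnerPoint_of_not_isOfFinAddOrder` (`HeegnerPointsKolyvaginExceptionalTwistProofs`);
* Gross–Zagier–Kolyvagin over `ℚ` for analytic rank `≤ 1` (`rank_eq_analyticRank_of_analyticRank_le_one` = item 19921) applied to `E`
  AND to `E^{(d_K)}`: ranks = analytic ranks, `Ш(E/ℚ)`, `Ш(E^{(d_K)}/ℚ)` finite;
* `rank E(K) = rank E(ℚ) + rank E^{(d_K)}(ℚ) ≤ 1` (Silverman Ex. 10.16, tree `mordellWeilRank_baseChange_quadratic_holds`) and `≥ 1`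
  (`y_K`; `one_le_mordellWeilRank_of_not_isOfFinAddOrder`); `Ш(E/K)` finite from the two over `ℚ` (`shaFinite_baseChange_of_shaFinite`).
This is the argument of the tree's `mordellWeilRank_eq_one_and_shaFinite_of_thmA_on` with "Theorem A on a class" replaced by the
route item GZK; no Euler system over `K` is used.

* `kolyvagin_of_grossZagier_of_rankEqAnalyticRank_of_entire` — **`(∀ N W K, gross_zagier N W K) → rank_eq_analyticRank_of_analyticRank_le_one →
  hasEntireLFunction_rat → ∀ N W K, kolyvagin N W K`** (Theses-free; feed the route items `GrossZagierAllLevels`,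
  `MultPublishedInputsAtTwo`, `EntireLFunctionRat` verbatim — they ARE these propositions);
* `stub_genusIndexLaw_of_fourFacts` / `stub_genusIndexLawPos_of_fourFacts` — LINE 18 / LINE 19 stub K over {GZ, GZK, L} (`…_of_kolyvagin`
  of `…GenusIndexLaw` / `…PosTGenusIndexLaw` composed with the bridge);
* `stub_milneDefect_of_fourFacts` / `stub_milneDefectPos_of_fourFacts` — gk2-p3's 3b″ closers (`stub_milneDefect(Pos)_of_facts`, p672162)
  over {GZ, GZK, L, Milne}.
So `PubInputsAtTwo` may return to its v4.1 shape (the four route items only), and the director's `…OfFourFacts` twins of L_T / L⁺_T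
(pen ask 23:32Z, precedent 22138 → 24238) display exactly `closes`'s `hGZ hGZK hL hMi`.

References: [GrossZagier1986] Thm. I.6.3, I.§7; [GrossLMS1991] (1.1), Thm. 1.3; [Darmon2004] Thm. 3.22, §3.9; [SilvermanAEC2009]
Exercise 10.16; [Milne1972ArithmeticAV] §1 Thm. 1; [Kolyvagin1990] Thm. A.
-/

set_option autoImplicit false
-- the Theorems namespace of this sub repeats the summit name by design (D-0017 nested layout)
set_option linter.dupNamespace false

noncomputable section

open scoped Classical

namespace Summit.BirchSwinnertonDyer.BirchSwinnertonDyer.Theorems.GenusExact.PlusDescent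

open WeierstrassCurve NumberField Literature.NumberTheory.EllipticCurves
  Literature.NumberTheory.EllipticCurves.ModularForms

/-- **Kolyvagin's theorem (the tree's named fact `kolyvagin`, Gross 1991 Thm. 1.3) FROM Gross–Zagier at all levels, Gross–Zagier–Kolyvagin
over `ℚ` in analytic rank `≤ 1`, and the entire continuation of `L(E,s)`**: for every level `N`, every elliptic `W/ℚ`, every imaginary
quadratic `K` with the Heegner hypothesis for `N` and every Heegner point `P ∈ E(K)` of level `N` of infinite order, `rank_ℤ E(K) = 1`
and `Ш(E/K)` is finite.  `L'(E/K,1) ≠ 0` (GZ) ⇒ `ord L(E) + ord L(E^{(d_K)}) ≤ 1` ⇒ GZK over `ℚ` for both ⇒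
`rank E(K) = rank E + rank E^{(d_K)} = 1` (it is `≥ 1` by `P`) and `Ш(E/K)` finite from `Ш(E)`, `Ш(E^{(d_K)})`.  CONDITIONAL on the three
displayed print facts (the route items 24148, 19921, 19273 verbatim); Theses-free.
[cite: GrossZagier1986, Thm. I.6.3 and I.§7] [cite: GrossLMS1991, (1.1) and Thm. 1.3] [cite: Darmon2004, Thm. 3.22 and §3.9]
[cite: SilvermanAEC2009, Exercise 10.16] -/
theorem kolyvagin_of_grossZagier_of_rankEqAnalyticRank_of_entire
    (hGZ : ∀ (N : ℕ) [NeZero N] (W : WeierstrassCurve ℚ) (K : Type) [Field K] [NumberField K],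
      gross_zagier N W K)
    (hGZK : rank_eq_analyticRank_of_analyticRank_le_one) (hL : WeierstrassCurve.hasEntireLFunction_rat) :
    ∀ (N : ℕ) [NeZero N] (W : WeierstrassCurve ℚ) (K : Type) [Field K] [NumberField K], kolyvagin N W K := by
  intro N _ W K _ _ _ hK hH P hP hnt
  haveI : (W.baseChange K).IsElliptic := by rw [WeierstrassCurve.baseChange]; infer_instance
  -- Gross–Zagier at `(N, E, K)`: `ord L(E) + ord L(E^{(d_K)}) ≤ 1`
  have hsum := analyticRank_add_le_one_of_isHeegnerPoint_of_not_isOfFinAddOrder hL (hGZ N W K) hK hH hP hnt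
  -- GZK over `ℚ` for `E` and for `E^{(d_K)}`
  have hd : (NumberField.discr K : ℚ) ≠ 0 := by exact_mod_cast NumberField.discr_ne_zero K
  haveI := W.isElliptic_quadraticTwist hd
  obtain ⟨hrW, hsW⟩ := hGZK W (by omega)
  obtain ⟨hrd, hsd⟩ := hGZK (W.quadraticTwist (NumberField.discr K : ℚ)) (by omega)
  -- the rank over `K`
  have hrk := mordellWeilRank_baseChange_quadratic_holds W K hK.1
  have hge : 1 ≤ (W.baseChange K).mordellWeilRank :=
    one_le_mordellWeilRank_of_not_isOfFinAddOrder _ (W.baseChange K).module_finite_point_holds hnt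
  exact ⟨by omega, shaFinite_baseChange_of_shaFinite W K hK.1 hsW hsd⟩

/-! ## The print stubs of LINES 18/19 over the route's four published items -/

/-- **LINE 18 v4.2 stub K `stub_genusIndexLaw` (L_T 23242) over {GZ all levels, GZK over `ℚ`, entire `L`}** (route items 24148, 19921,
19273 verbatim): the v4 statement VERBATIM.  [cite: DokchitserDokchitserAnnals2010, Conj. 2.1] [cite: GrossLMS1991, Thm. 1.3] -/
theorem stub_genusIndexLaw_of_fourFacts
    (hGZ : ∀ (N : ℕ) [NeZero N] (W : WeierstrassCurve ℚ) (K : Type) [Field K] [NumberField K],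
      gross_zagier N W K)
    (hGZK : rank_eq_analyticRank_of_analyticRank_le_one) (hL : WeierstrassCurve.hasEntireLFunction_rat) :
    ∀ (W : WeierstrassCurve ℚ) [W.IsElliptic] [W.IsGloballyMinimal] [NeZero (W.conductorNorm ℤ)], Odd W.tamagawaProduct → W.Δ < 0 → ∀ (K : Type) [Field K] [NumberField K], Literature.NumberTheory.EllipticCurves.IsImaginaryQuadratic K → Odd (NumberField.discr K) → NumberField.discr K ≠ -3 → Literature.NumberTheory.EllipticCurves.SatisfiesHeegnerHypothesis (W.conductorNorm ℤ) K → (∀ n : ℕ, 0 < n → W.HasSurjectiveModNGaloisRep ((2 : ℤ) ^ n)) → ∀ (Dt : Literature.NumberTheory.EllipticCurves.ModularForms.ModularParametrizationData W (W.conductorNorm ℤ)) (β : ℤ) (ι : K →+* ℂ) (d₁ : Literature.NumberTheory.EllipticCurves.KolyvaginHeegnerData Dt β ι 1), ¬ IsOfFinAddOrder d₁.derivedPoint → ∀ (Wd : WeierstrassCurve ℚ) [Wd.IsElliptic] [Wd.IsGloballyMinimal], (∃ C : WeierstrassCurve.VariableChange ℚ, C • W.quadraticTwist (NumberField.discr K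 : ℚ) = Wd) → ∃ q : ℚ, q ≠ 0 ∧ (q : ℝ) = (W.regulator * W.bsdPeriod * ((W.modifiedTamagawaProduct : ℚ) : ℝ) / ((W.torsionOrder : ℕ) : ℝ) ^ 2) * (Wd.regulator * Wd.bsdPeriod * ((Wd.modifiedTamagawaProduct : ℚ) : ℝ) / ((Wd.torsionOrder : ℕ) : ℝ) ^ 2) / ((W.baseChange K).regulator * (W.baseChange K).bsdPeriod * (((W.baseChange K).modifiedTamagawaProduct : ℚ) : ℝ) / (((W.baseChange K).torsionOrder : ℕ) : ℝ) ^ 2) ∧ padicValRat 2 q = (padicValNat 2 Wd.tamagawaProduct : ℤ) - 1 :=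
  stub_genusIndexLaw_of_kolyvagin (kolyvagin_of_grossZagier_of_rankEqAnalyticRank_of_entire hGZ hGZK hL)

/-- **LINE 19 v4.2 stub K `stub_genusIndexLaw` (L⁺_T 23379, `Δ > 0`) over {GZ, GZK, L}**: the v4.2 statement after `PubInputsAtTwo →`
VERBATIM.  [cite: DokchitserDokchitserAnnals2010, Conj. 2.1] [cite: GrossLMS1991, Thm. 1.3] -/
theorem stub_genusIndexLawPos_of_fourFacts
    (hGZ : ∀ (N : ℕ) [NeZero N] (W : WeierstrassCurve ℚ) (K : Type) [Field K] [NumberField K],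
      gross_zagier N W K)
    (hGZK : rank_eq_analyticRank_of_analyticRank_le_one) (hL : WeierstrassCurve.hasEntireLFunction_rat) :
    ∀ (W : WeierstrassCurve ℚ) [W.IsElliptic] [W.IsGloballyMinimal] [NeZero (W.conductorNorm ℤ)], Odd W.tamagawaProduct → 0 < W.Δ → ∀ (K : Type) [Field K] [NumberField K], Literature.NumberTheory.EllipticCurves.IsImaginaryQuadratic K → Odd (NumberField.discr K) → NumberField.discr K ≠ -3 → Literature.NumberTheory.EllipticCurves.SatisfiesHeegnerHypothesis (W.conductorNorm ℤ) K → (∀ n : ℕ, 0 < n → W.HasSurjectiveModNGaloisRep ((2 : ℤ) ^ n)) → ∀ (Dt : Literature.NumberTheory.EllipticCurves.ModularForms.ModularParametrizationData W (W.conductorNorm ℤ)) (β : ℤ) (ι : K →+* ℂ) (d₁ : Literature.NumberTheory.EllipticCurves.KolyvaginHeegnerData Dt β ι 1), ¬ IsOfFinAddOrder d₁.derivedPoint → ∀ (Wd : WeierstrassCurve ℚ) [Wd.IsElliptic] [Wd.IsGloballyMinimal], (∃ C : WeierstrassCurve.VariableChange ℚ, C • W.quadraticTwist (NumberField.discr K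 : ℚ) = Wd) → ∃ q : ℚ, q ≠ 0 ∧ (q : ℝ) = (W.regulator * W.bsdPeriod * ((W.modifiedTamagawaProduct : ℚ) : ℝ) / ((W.torsionOrder : ℕ) : ℝ) ^ 2) * (Wd.regulator * Wd.bsdPeriod * ((Wd.modifiedTamagawaProduct : ℚ) : ℝ) / ((Wd.torsionOrder : ℕ) : ℝ) ^ 2) / ((W.baseChange K).regulator * (W.baseChange K).bsdPeriod * (((W.baseChange K).modifiedTamagawaProduct : ℚ) : ℝ) / (((W.baseChange K).torsionOrder : ℕ) : ℝ) ^ 2) ∧ padicValRat 2 q = (padicValNat 2 Wd.tamagawaProduct : ℤ) :=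
  stub_genusIndexLawPos_of_kolyvagin (kolyvagin_of_grossZagier_of_rankEqAnalyticRank_of_entire hGZ hGZK hL)

/-- **LINE 18 v4.2 stub 3b″ `stub_milneDefect` (L_T 23242) over the FOUR route items {GZ, GZK, L, Milne}** (gk2-p3's p672162
`stub_milneDefect_of_facts` composed with the bridge).  [cite: Milne1972ArithmeticAV, §1 Thm. 1] [cite: GrossLMS1991, Thm. 1.3] -/
theorem stub_milneDefect_of_fourFacts
    (hGZ : ∀ (N : ℕ) [NeZero N] (W : WeierstrassCurve ℚ) (K : Type) [Field K] [NumberField K],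
      gross_zagier N W K)
    (hGZK : rank_eq_analyticRank_of_analyticRank_le_one) (hL : WeierstrassCurve.hasEntireLFunction_rat)
    (hMilne : Milne1972.bsdQuotient_baseChange_quadratic_anyModel) :
    ∀ (W : WeierstrassCurve ℚ) [W.IsElliptic] [W.IsGloballyMinimal] [NeZero (W.conductorNorm ℤ)], ¬ W.HasCM →
      Odd W.tamagawaProduct → W.Δ < 0 →
      ∀ (K : Type) [Field K] [NumberField K], Literature.NumberTheory.EllipticCurves.IsImaginaryQuadratic K →
      Odd (NumberField.discr K) → NumberField.discr K ≠ -3 →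
      Literature.NumberTheory.EllipticCurves.SatisfiesHeegnerHypothesis (W.conductorNorm ℤ) K →
      ¬ IsSquare ((NumberField.discr K : ℚ) * -|W.Δ|) →
      ¬ IsSquare ((NumberField.discr K : ℚ) * (-(2 * |W.Δ|))) → (∀ n : ℕ, 0 < n →
      W.HasSurjectiveModNGaloisRep ((2 : ℤ) ^ n)) →
      ∀ (Dt : Literature.NumberTheory.EllipticCurves.ModularForms.ModularParametrizationData W (W.conductorNorm ℤ)) (β : ℤ) (ι : K →+* ℂ) (d₁ : Literature.NumberTheory.EllipticCurves.KolyvaginHeegnerData Dt β ι 1), ¬ IsOfFinAddOrder d₁.derivedPoint →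
      ∀ (M₀ : ℕ),
        (∃ Q : (W.baseChange (Literature.NumberTheory.EllipticCurves.ringClassField K ι 1)).toAffine.Point,
        ((2 ^ M₀ : ℕ) : ℤ) • Q = d₁.derivedPoint) →
      (¬ ∃ Q : (W.baseChange (Literature.NumberTheory.EllipticCurves.ringClassField K ι 1)).toAffine.Point,
        ((2 ^ (M₀ + 1) : ℕ) : ℤ) • Q = d₁.derivedPoint) →
      ∀ (n : ℕ) (d : Literature.NumberTheory.EllipticCurves.KolyvaginHeegnerData Dt β ι n), Squarefree n →
      (∀ ℓ ∈ n.primeFactors,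
        Literature.NumberTheory.EllipticCurves.Zhang2014.IsKolyvaginPrime (W.conductorNorm ℤ) W K 2 ℓ) →
      (¬ ∃ Q : (W.baseChange (Literature.NumberTheory.EllipticCurves.ringClassField K ι n)).toAffine.Point,
        (2 : ℤ) • Q = d.derivedPoint) →
      ∀ (Wd : WeierstrassCurve ℚ) [Wd.IsElliptic] [Wd.IsGloballyMinimal],
        (∃ C : WeierstrassCurve.VariableChange ℚ, C • W.quadraticTwist (NumberField.discr K : ℚ) = Wd) →
      0 < Nat.card (AddCommGroup.primaryComponent W.sha 2) ∧
      0 < Nat.card (AddCommGroup.primaryComponent Wd.sha 2) ∧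
      0 < Nat.card (AddCommGroup.primaryComponent (W.baseChange K).sha 2) ∧ ∃ q : ℚ, q ≠ 0 ∧
      (q : ℝ) = (W.regulator * W.bsdPeriod * ((W.modifiedTamagawaProduct : ℚ) : ℝ) /
        ((W.torsionOrder : ℕ) : ℝ) ^ 2) * (Wd.regulator * Wd.bsdPeriod *
        ((Wd.modifiedTamagawaProduct : ℚ) : ℝ) / ((Wd.torsionOrder : ℕ) : ℝ) ^ 2) /
        ((W.baseChange K).regulator * (W.baseChange K).bsdPeriod *
        (((W.baseChange K).modifiedTamagawaProduct : ℚ) : ℝ) /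
        (((W.baseChange K).torsionOrder : ℕ) : ℝ) ^ 2) ∧
      (padicValNat 2 (Nat.card (AddCommGroup.primaryComponent (W.baseChange K).sha 2)) : ℤ) =
        (padicValNat 2 (Nat.card (AddCommGroup.primaryComponent W.sha 2)) : ℤ) + (padicValNat 2 (Nat.card (AddCommGroup.primaryComponent Wd.sha 2)) : ℤ) + padicValRat 2 q :=
  stub_milneDefect_of_facts (kolyvagin_of_grossZagier_of_rankEqAnalyticRank_of_entire hGZ hGZK hL) hMilne

/-- **LINE 19 v4.2 stub 3b″ `stub_milneDefect` (L⁺_T 23379, `Δ > 0`) over the FOUR route items {GZ, GZK, L, Milne}** (gk2-p3's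
`stub_milneDefectPos_of_facts` composed with the bridge).  [cite: Milne1972ArithmeticAV, §1 Thm. 1] [cite: GrossLMS1991, Thm. 1.3] -/
theorem stub_milneDefectPos_of_fourFacts
    (hGZ : ∀ (N : ℕ) [NeZero N] (W : WeierstrassCurve ℚ) (K : Type) [Field K] [NumberField K],
      gross_zagier N W K)
    (hGZK : rank_eq_analyticRank_of_analyticRank_le_one) (hL : WeierstrassCurve.hasEntireLFunction_rat)
    (hMilne : Milne1972.bsdQuotient_baseChange_quadratic_anyModel) :
    ∀ (W : WeierstrassCurve ℚ) [W.IsElliptic] [W.IsGloballyMinimal] [NeZero (W.conductorNorm ℤ)], ¬ W.HasCM →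
      Odd W.tamagawaProduct → 0 < W.Δ →
      ∀ (K : Type) [Field K] [NumberField K], Literature.NumberTheory.EllipticCurves.IsImaginaryQuadratic K →
      Odd (NumberField.discr K) → NumberField.discr K ≠ -3 →
      Literature.NumberTheory.EllipticCurves.SatisfiesHeegnerHypothesis (W.conductorNorm ℤ) K →
      ¬ IsSquare ((NumberField.discr K : ℚ) * -|W.Δ|) →
      ¬ IsSquare ((NumberField.discr K : ℚ) * (-(2 * |W.Δ|))) → (∀ n : ℕ, 0 < n →
      W.HasSurjectiveModNGaloisRep ((2 : ℤ) ^ n)) →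
      ∀ (Dt : Literature.NumberTheory.EllipticCurves.ModularForms.ModularParametrizationData W (W.conductorNorm ℤ)) (β : ℤ) (ι : K →+* ℂ) (d₁ : Literature.NumberTheory.EllipticCurves.KolyvaginHeegnerData Dt β ι 1), ¬ IsOfFinAddOrder d₁.derivedPoint →
      ∀ (M₀ : ℕ),
        (∃ Q : (W.baseChange (Literature.NumberTheory.EllipticCurves.ringClassField K ι 1)).toAffine.Point,
        ((2 ^ M₀ : ℕ) : ℤ) • Q = d₁.derivedPoint) →
      (¬ ∃ Q : (W.baseChange (Literature.NumberTheory.EllipticCurves.ringClassField K ι 1)).toAffine.Point,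
        ((2 ^ (M₀ + 1) : ℕ) : ℤ) • Q = d₁.derivedPoint) →
      ∀ (n : ℕ) (d : Literature.NumberTheory.EllipticCurves.KolyvaginHeegnerData Dt β ι n), Squarefree n →
      (∀ ℓ ∈ n.primeFactors,
        Literature.NumberTheory.EllipticCurves.Zhang2014.IsKolyvaginPrime (W.conductorNorm ℤ) W K 2 ℓ) →
      (¬ ∃ Q : (W.baseChange (Literature.NumberTheory.EllipticCurves.ringClassField K ι n)).toAffine.Point,
        (2 : ℤ) • Q = d.derivedPoint) →
      ∀ (Wd : WeierstrassCurve ℚ) [Wd.IsElliptic] [Wd.IsGloballyMinimal],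
        (∃ C : WeierstrassCurve.VariableChange ℚ, C • W.quadraticTwist (NumberField.discr K : ℚ) = Wd) →
      0 < Nat.card (AddCommGroup.primaryComponent W.sha 2) ∧
      0 < Nat.card (AddCommGroup.primaryComponent Wd.sha 2) ∧
      0 < Nat.card (AddCommGroup.primaryComponent (W.baseChange K).sha 2) ∧ ∃ q : ℚ, q ≠ 0 ∧
      (q : ℝ) = (W.regulator * W.bsdPeriod * ((W.modifiedTamagawaProduct : ℚ) : ℝ) /
        ((W.torsionOrder : ℕ) : ℝ) ^ 2) * (Wd.regulator * Wd.bsdPeriod *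
        ((Wd.modifiedTamagawaProduct : ℚ) : ℝ) / ((Wd.torsionOrder : ℕ) : ℝ) ^ 2) /
        ((W.baseChange K).regulator * (W.baseChange K).bsdPeriod *
        (((W.baseChange K).modifiedTamagawaProduct : ℚ) : ℝ) /
        (((W.baseChange K).torsionOrder : ℕ) : ℝ) ^ 2) ∧
      (padicValNat 2 (Nat.card (AddCommGroup.primaryComponent (W.baseChange K).sha 2)) : ℤ) =
        (padicValNat 2 (Nat.card (AddCommGroup.primaryComponent W.sha 2)) : ℤ) + (padicValNat 2 (Nat.card (AddCommGroup.primaryComponent Wd.sha 2)) : ℤ) + padicValRat 2 q :=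
  stub_milneDefectPos_of_facts (kolyvagin_of_grossZagier_of_rankEqAnalyticRank_of_entire hGZ hGZK hL) hMilne

end Summit.BirchSwinnertonDyer.BirchSwinnertonDyer.Theorems.GenusExact.PlusDescent

end
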